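import Summits.CriticalPhenomena.SAWScalingLimit.Theorems.SAWTotalPositivityCriticalBubbleBoundJoinMassBootstrap

/-!
# Pointwise proved window of the bubble series (line `docking-census-joining`, crux
`SAWTotalPositivity.CriticalBubbleBound`, stmt-CriticalPhenomena-7117)

The crux is the finiteness of `Σ_n t_n`, `t_n = term n = c_n(0,e₀) x_c^n` (rooted critical polygon
mass). The join-mass bootstrap (`JoinMassBootstrap`) landed Hammond's theorem in BLOCK form:
`blockMass cterm i ≤ C_s 2^{s i}` for every `s > -1/2` and `blockMass term i ≤ C_s 2^{s i}` for every
`s > 1/2`, where `blockMass t i = Σ_{n ∈ [2^i, 2^{i+1})} t n`.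

This file records the POINTWISE corollary (registered stubs `join_cterm_le_rpow`,
`join_term_le_rpow`): a nonnegative term is at most its block sum, and on the block `B_i ∋ n` one has
`2^{s i} ≤ 2^{|s|} (n+1)^s`; hence

* `cterm n = q_{n+1} x_c^{n+1} = O((n+1)^{-1/2+ε})` for ALL `n` (Madras' pointwise exponent
  `θ ≥ 1/2` for the polygon classes, here as a corollary of Hammond's block form), and
* `term n = t_n = O((n+1)^{1/2+ε})` for ALL `n` — the pointwise proved window of the crux series moves
  from Hammersley–Welsh `t_n ≤ e^{κ √n}` and `O(n^{3/2})` to `O(n^{1/2+ε})`; the crux asks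
  `Σ_n t_n < ∞`.

Sources: A. Hammond, *An upper bound on the number of self-avoiding polygons via joining*,
Ann. Probab. 46 (2018), Theorem 1.3; N. Madras, G. Slade, *The Self-Avoiding Walk* (1993), §1.4.
-/

noncomputable section

open Literature.Probability.LatticeModels
open Literature.Probability.RandomPlanarGeometry Literature.Probability.RandomPlanarGeometry.SAW
open scoped BigOperators
open Summit.CriticalPhenomena.SAWScalingLimit.Theorems.CriticalBubbleBound.Negative (e₀)
open Summit.CriticalPhenomena.SAWScalingLimit.Theorems.CriticalBubbleBound.Docking

namespace Summit.CriticalPhenomena.SAWScalingLimit.Theorems.CriticalBubbleBound.Join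

/-- On the dyadic block `B_i ∋ n`: `2^{s i} ≤ 2^{|s|} (n+1)^s` (both signs of `s`). [folklore] -/
theorem two_rpow_mul_le_on_block {i n : ℕ} (hn : n ∈ block i) (s : ℝ) :
    (2 : ℝ) ^ (s * (i : ℝ)) ≤ (2 : ℝ) ^ |s| * ((n : ℝ) + 1) ^ s := by
  have h := rpow_succ_ge_on_block hn s
  have h2 : (0 : ℝ) ≤ (2 : ℝ) ^ |s| := Real.rpow_nonneg (by norm_num) _
  have h3 := mul_le_mul_of_nonneg_left h h2
  rwa [← mul_assoc, ← Real.rpow_add (by norm_num : (0 : ℝ) < 2), add_neg_cancel, Real.rpow_zero,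
    one_mul] at h3

/-- **Pointwise from blocks**: a nonnegative sequence whose dyadic block sums are at most `C 2^{s i}`
is pointwise at most `(t 0 + C 2^{|s|}) (n+1)^s` (a term is at most its block sum, and
`2^{s i} ≤ 2^{|s|} (n+1)^s` on `B_i`; the summand `t 0` covers `n = 0 ∉ ⋃ B_i`). [folklore] -/
theorem le_rpow_of_blockMass_le {t : ℕ → ℝ} (ht : ∀ n, 0 ≤ t n) {s C : ℝ}
    (hC : ∀ i : ℕ, blockMass t i ≤ C * (2 : ℝ) ^ (s * (i : ℝ))) :
    ∀ n : ℕ, t n ≤ (t 0 + C * (2 : ℝ) ^ |s|) * ((n : ℝ) + 1) ^ s := by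
  have hC0 : 0 ≤ C := by
    have h := (blockMass_nonneg ht 0).trans (hC 0)
    rwa [Nat.cast_zero, mul_zero, Real.rpow_zero, mul_one] at h
  have hK : 0 ≤ C * (2 : ℝ) ^ |s| := mul_nonneg hC0 (Real.rpow_nonneg (by norm_num) _)
  intro n
  rcases eq_or_ne n 0 with rfl | hn
  · rw [Nat.cast_zero, zero_add, Real.one_rpow, mul_one]
    exact le_add_of_nonneg_right hK
  · have hmem := mem_block_log hn
    have h1 : t n ≤ blockMass t (Nat.log 2 n) := Finset.single_le_sum (fun m _ => ht m) hmem
    have hpos : (0 : ℝ) ≤ ((n : ℝ) + 1) ^ s := Real.rpow_nonneg (by positivity) s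
    calc t n ≤ C * (2 : ℝ) ^ (s * ((Nat.log 2 n : ℕ) : ℝ)) := h1.trans (hC _)
      _ ≤ C * ((2 : ℝ) ^ |s| * ((n : ℝ) + 1) ^ s) :=
          mul_le_mul_of_nonneg_left (two_rpow_mul_le_on_block hmem s) hC0
      _ = C * (2 : ℝ) ^ |s| * ((n : ℝ) + 1) ^ s := (mul_assoc _ _ _).symm
      _ ≤ (t 0 + C * (2 : ℝ) ^ |s|) * ((n : ℝ) + 1) ^ s :=
          mul_le_mul_of_nonneg_right (le_add_of_nonneg_left (ht 0)) hpos

/-- A block decay `blockMass t i ≤ C_s 2^{s i}` for every `s > s₀` of a nonnegative sequence gives the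
pointwise bound `t n ≤ C'_s (n+1)^s` for every `s > s₀`. [folklore] -/
theorem pointwise_of_blockDecay {t : ℕ → ℝ} (ht : ∀ n, 0 ≤ t n) {s₀ : ℝ}
    (hdec : ∀ s : ℝ, s₀ < s → ∃ C : ℝ, ∀ i : ℕ, blockMass t i ≤ C * (2 : ℝ) ^ (s * (i : ℝ))) :
    ∀ s : ℝ, s₀ < s → ∃ C : ℝ, ∀ n : ℕ, t n ≤ C * ((n : ℝ) + 1) ^ s := by
  intro s hs
  obtain ⟨C, hC⟩ := hdec s hs
  exact ⟨_, le_rpow_of_blockMass_le ht hC⟩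

/-- **Pointwise proved window, classes**: `q_{n+1} x_c^{n+1} ≤ #lexRooted n · x_c^{n+1} = cterm n ≤
C_s (n+1)^s` for every `s > -1/2` and ALL `n` — the polygon number deficit `θ ≥ 3/2 - ε` of
Hammond's theorem holds pointwise in the weak form `θ_n ≥ 1/2 - ε` off NO exceptional set
(a term is at most its dyadic block sum). [cite: Hammond2015SAPJoining, Theorem 1.3] -/
theorem join_cterm_le_rpow : ∀ s : ℝ, -(1 : ℝ) / 2 < s → ∃ C : ℝ, ∀ n : ℕ, cterm n ≤ C * ((n : ℝ) + 1) ^ s :=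
  pointwise_of_blockDecay cterm_nonneg join_blockMass_cterm_le

/-- **Pointwise proved window, crux currency**: `t_n = c_n(0,e₀) x_c^n ≤ C_s (n+1)^s` for every
`s > 1/2` and ALL `n` (from the block form `R_i ≤ C_s 2^{s i}`; the crux `Σ_n t_n < ∞` needs
summability, i.e. two more units of decay in block average). [cite: Hammond2015SAPJoining, Theorem 1.3] -/
theorem join_term_le_rpow : ∀ s : ℝ, (1 : ℝ) / 2 < s → ∃ C : ℝ, ∀ n : ℕ, term n ≤ C * ((n : ℝ) + 1) ^ s :=
  pointwise_of_blockDecay term_nonneg join_blockMass_term_le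

end Summit.CriticalPhenomena.SAWScalingLimit.Theorems.CriticalBubbleBound.Join

end
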